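import Mathlib.Analysis.InnerProductSpace.Projection.Basic
import Mathlib.Analysis.CStarAlgebra.Matrix
import Mathlib.LinearAlgebra.Matrix.Trace
import Mathlib.LinearAlgebra.Matrix.PosDef
import Mathlib.Data.ZMod.Basic
import Literature.MathematicalPhysics.QuantumLattice.FinDimSpectrum
import Literature.MathematicalPhysics.QuantumLattice.SpinSystem
import Literature.MathematicalPhysics.QuantumLattice.HeisenbergModel
import HarnessLib

-- provenance: harness21/H21/H21/Prelude/QLatticeAQFT/MatrixProductStates.lean @ 96a2136 (interim HEAD d8f2665); M5 mechanical rewrite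
/-!
# Matrix product states (trunk QLatticeAQFT, item Q9; notion `matrix_product_state`)

A *matrix product state* (finitely correlated state) on a chain of `L` sites with local
dimension `q` and bond dimension `D` is determined by a tensor `A : Fin q → M_D(ℂ)`; its
amplitudes are

* periodic boundary conditions: `ψ(σ₁,…,σ_L) = tr (A^{σ₁} ⋯ A^{σ_L})` (`mpsPeriodic`),
* open boundary conditions: `ψ(σ) = ⟨l| A^{σ₁} ⋯ A^{σ_L} |r⟩` (`mpsOpen`),
* boundary matrix `B`: `ψ_B(σ) = tr (B A^{σ₁} ⋯ A^{σ_L})` (`mpsWithBoundary`).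

We also define the transfer operator (completely positive map) `𝔼(X) = Σ_i A^i X (A^i)†`
(`transferOp`, an honest `ℂ`-linear map), word products `A^{w₁} ⋯ A^{w_ℓ}` (`wordProduct`),
injectivity (`IsInjectiveMPS A ℓ`: the words of length `ℓ` span `M_D(ℂ)`) and normality
(`IsNormalMPS A`: injective for some *positive* block length, equivalently the transfer operator
is primitive), the space `𝒢_ℓ = {ψ_B : B ∈ M_D(ℂ)}` of MPS on `ℓ` sites with arbitrary boundary
(`mpsRange`), the parent-Hamiltonian local term `h = 1 - P_{𝒢_ℓ}` (`parentLocalTerm`, the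
projection onto `𝒢_ℓᗮ`), the translation-invariant parent Hamiltonian on the ring `ℤ/L`
(`parentHamiltonian`) and on the open chain (`parentHamiltonianOpen`), and the AKLT tensor
`akltTensor` (`D = 2`, `q = 3`).

API (proofs `sorry` unless trivial): `transferOp_apply` (by `simp`), `mpsPeriodic_shift`,
`transferOp_posSemidef` (proved), `IsInjectiveMPS.mono` (for `0 < ℓ`),
`isNormalMPS_akltTensor`, `parentHamiltonian_akltTensor_eq`
(the AKLT parent Hamiltonian with `ℓ = 2` is `Σ_i P₂(i,i+1) = ½ H_AKLT + L/3`),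
`parentHamiltonian_mulVec_mps_eq_zero` (the MPS is a zero-energy ground state of its parent
Hamiltonian).

## Sources

* M. Fannes, B. Nachtergaele, R. F. Werner, *Finitely correlated states on quantum spin chains*,
  Comm. Math. Phys. **144** (1992) 443–490, §2 (definition), §4–§6 (transfer operator, parent
  Hamiltonian, ground-state property), §7 (AKLT example).
* D. Perez-Garcia, F. Verstraete, M. M. Wolf, J. I. Cirac, *Matrix product state representations*,
  Quantum Inf. Comput. **7** (2007) 401–430, §2 (MPS with PBC/OBC), §3.2 (injectivity, normality,
  Def. 4 and Lemma 4), §4 (parent Hamiltonians, Thm. 10).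
* I. Affleck, T. Kennedy, E. H. Lieb, H. Tasaki, CMP **115** (1988) 477 (AKLT model);
  U. Schollwöck, Ann. Phys. **326** (2011) 96, §4.1.5 (AKLT tensor
  `A⁺ = √(2/3) σ⁺, A⁰ = -√(1/3) σᶻ, A⁻ = -√(2/3) σ⁻`).

## Mathlib / H21 status and design choices

* Mathlib has no matrix product states, transfer operators of MPS or parent Hamiltonians
  (grepped `MPS`, `matrixProduct`, `transferOp`, `parentHamiltonian`: nothing relevant). Used from
  Mathlib: `List.ofFn`, `List.prod`, `Matrix.trace`, `LinearMap.mulLeftRight` (so that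
  `transferOp_apply` follows by `simp` from `LinearMap.sum_apply`/`LinearMap.mulLeftRight_apply`),
  `Submodule.span`, `Submodule.orthogonal` (`ᗮ`), `Matrix.PosSemidef`, `ZMod.finEquiv`,
  `finRotate`, `Matrix.submatrix`. Used from H21: `TensorIndex`, `SpinSpace`, `Op`, `localOp`
  (`SpinSystem`), `projMatrix` (`FinDimSpectrum`), `spinDot` (`HeisenbergModel`, only for the
  AKLT identification lemma; it transitively provides `SpinOperators`). The outline dependencies
  `SpinOperators`/`LocalDynamics` are not imported directly since nothing from them is used here.
* `mpsPeriodic`, `mpsOpen`, `mpsWithBoundary` are all expressed through `wordProduct`, so that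
  `mpsPeriodic L A σ = (wordProduct A σ).trace` is `rfl`.
* `mpsOpen L A l r σ = l ⬝ᵥ (A^{σ₀} ⋯ A^{σ_{L-1}}) r` uses the *bilinear* pairing (`lᵀ W r`, no
  complex conjugation of `l`); PVWC's `⟨φ_L| W |φ_R⟩` is antilinear in `φ_L`, so their `φ_L`
  corresponds to `star l` here. This is only a parametrisation of the same family of states.
* `IsNormalMPS A := ∃ ℓ, 0 < ℓ ∧ IsInjectiveMPS A ℓ` requires a *positive* block length: for
  `ℓ = 0` the only word product is the empty product `1`, which spans `M_D(ℂ)` whenever `D ≤ 1`,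
  so allowing `ℓ = 0` would make e.g. the zero tensor with `D = 1` normal. With `0 < ℓ`,
  injectivity propagates to all larger lengths (`IsInjectiveMPS.mono`, PVWC Lemma 4), so the
  definition agrees with "injective for all sufficiently large `ℓ`". Degenerate case: for `D = 0`
  (`M₀(ℂ)` is the zero ring, `⊤ = ⊥`) every tensor is injective for every `ℓ`, hence normal;
  downstream statements about normal MPS must assume `0 < D`.
* `parentHamiltonian L ℓ A : Op (ZMod L) q` places the `ℓ`-site term on every block
  `{x, x+1, …, x+ℓ-1} ⊆ ℤ/L` via `localOp`; the identification of the block with `Fin ℓ` is the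
  map `i ↦ x + i`, and the local term is pulled back along it with `Matrix.submatrix`. This is the
  honest reindexing when `ℓ ≤ L` (the map is injective); for `ℓ > L` the definition is a
  documented junk value. Statements assume `ℓ ≤ L` (and `NeZero L`).
* `parentHamiltonianOpen L ℓ A : Op (Fin L) q` sums over left endpoints `x` with `x + ℓ ≤ L`
  (a `dite`, no natural subtraction).
* Physical index convention for spin `1` (`q = 3`): `k : Fin 3 ↦ m = 1 - k` as in
  `Literature.MathematicalPhysics.QuantumLattice.SpinOperators.spinZ`, so `akltTensor 0 = A⁺`, `akltTensor 1 = A⁰`, `akltTensor 2 = A⁻`.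
* This file imports `Literature.Prelude.QLatticeAQFT.HeisenbergModel` (accepted, same trunk) for
  `spinDot` in `parentHamiltonian_akltTensor_eq`.
-/

noncomputable section

open Matrix Complex
open scoped ComplexOrder

namespace Literature.MathematicalPhysics.QuantumLattice

section QLattice

/-! ### Tensors, word products, MPS amplitudes -/

/-- An MPS tensor with physical dimension `q` and bond dimension `D`: a family of `q` complex
`D × D` matrices `A^i`, `i : Fin q`. Fannes–Nachtergaele–Werner (1992) §2;
Perez-Garcia–Verstraete–Wolf–Cirac (2007) §2. [cite: FannesNachtergaeleWernerCMP1992] -/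
abbrev MPSTensor (q D : ℕ) : Type := Fin q → Matrix (Fin D) (Fin D) ℂ

variable {q D : ℕ}

/-- The word product `A^{w₀} A^{w₁} ⋯ A^{w_{ℓ-1}}` of an MPS tensor along a word `w : Fin ℓ → Fin q`
(the empty word gives `1`). Perez-Garcia–Verstraete–Wolf–Cirac (2007) §3.2.
[cite: PerezGarciaVerstraeteWolfCiracQIC2007] -/
def wordProduct {ℓ : ℕ} (A : MPSTensor q D) (w : Fin ℓ → Fin q) : Matrix (Fin D) (Fin D) ℂ :=
  (List.ofFn fun i => A (w i)).prod

/-- The translation-invariant MPS with periodic boundary conditions on `L` sites,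
`ψ(σ) = tr (A^{σ₀} A^{σ₁} ⋯ A^{σ_{L-1}})`. Fannes–Nachtergaele–Werner (1992) §2;
Perez-Garcia–Verstraete–Wolf–Cirac (2007) §2, eq. (2). [cite: FannesNachtergaeleWernerCMP1992] -/
def mpsPeriodic (L : ℕ) (A : MPSTensor q D) : TensorIndex (Fin L) q → ℂ :=
  fun σ => (wordProduct A σ).trace

/-- The MPS with open boundary conditions and boundary vectors `l, r ∈ ℂ^D`,
`ψ(σ) = ⟨l| A^{σ₀} ⋯ A^{σ_{L-1}} |r⟩ = l ⬝ᵥ (A^{σ₀} ⋯ A^{σ_{L-1}}) r` (no complex conjugation of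
`l`). Perez-Garcia–Verstraete–Wolf–Cirac (2007) §2, eq. (1); AKLT (1988) §2.
[cite: PerezGarciaVerstraeteWolfCiracQIC2007] -/
def mpsOpen (L : ℕ) (A : MPSTensor q D) (l r : Fin D → ℂ) : TensorIndex (Fin L) q → ℂ :=
  fun σ => l ⬝ᵥ (wordProduct A σ *ᵥ r)

/-- The MPS with boundary matrix `B`, `ψ_B(σ) = tr (B A^{σ₀} ⋯ A^{σ_{L-1}})`; `B = 1` is the
periodic MPS and rank-one `B = r lᵀ` the open one. These span the ground space of the parent
Hamiltonian on `L` sites. Fannes–Nachtergaele–Werner (1992) §5;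
Perez-Garcia–Verstraete–Wolf–Cirac (2007) §4. [cite: FannesNachtergaeleWernerCMP1992] -/
def mpsWithBoundary (L : ℕ) (A : MPSTensor q D) (B : Matrix (Fin D) (Fin D) ℂ) :
    TensorIndex (Fin L) q → ℂ :=
  fun σ => (B * wordProduct A σ).trace

/-- Unfolding `mpsPeriodic`. [folklore] -/
theorem mpsPeriodic_apply (L : ℕ) (A : MPSTensor q D) (σ : TensorIndex (Fin L) q) :
    mpsPeriodic L A σ = (wordProduct A σ).trace := rfl

/-- The periodic MPS is the boundary MPS with `B = 1`. [folklore] -/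
@[simp]
theorem mpsWithBoundary_one (L : ℕ) (A : MPSTensor q D) :
    mpsWithBoundary L A 1 = mpsPeriodic L A := by
  funext σ
  simp [mpsWithBoundary, mpsPeriodic]

/-- Translation invariance of the periodic MPS: `ψ(σ ∘ shift) = ψ(σ)` (cyclicity of the trace).
Fannes–Nachtergaele–Werner (1992) §2; Perez-Garcia–Verstraete–Wolf–Cirac (2007) §3.2.2.
[cite: FannesNachtergaeleWernerCMP1992] -/
def mpsPeriodic_shift : Prop :=
  ∀ (L : ℕ) (A : MPSTensor q D) (σ : TensorIndex (Fin L) q),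
    mpsPeriodic L A (σ ∘ finRotate L) = mpsPeriodic L A σ

/-! ### Transfer operator, injectivity, normality -/

/-- The **transfer operator** (completely positive map) of the MPS tensor `A`,
`𝔼(X) = Σ_i A^i X (A^i)†`, as a `ℂ`-linear map on `M_D(ℂ)`.
Fannes–Nachtergaele–Werner (1992) §2, eq. (2.4); Perez-Garcia–Verstraete–Wolf–Cirac (2007) §2.1.
[cite: FannesNachtergaeleWernerCMP1992] -/
def transferOp (A : MPSTensor q D) : Matrix (Fin D) (Fin D) ℂ →ₗ[ℂ] Matrix (Fin D) (Fin D) ℂ :=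
  ∑ i : Fin q, LinearMap.mulLeftRight ℂ (A i, (A i)ᴴ)

/-- `𝔼(X) = Σ_i A^i X (A^i)†`. [folklore] -/
@[simp]
theorem transferOp_apply (A : MPSTensor q D) (X : Matrix (Fin D) (Fin D) ℂ) :
    transferOp A X = ∑ i : Fin q, A i * X * (A i)ᴴ := by
  simp [transferOp]

/-- The transfer operator is (completely) positive: it maps positive semidefinite matrices to
positive semidefinite matrices. Fannes–Nachtergaele–Werner (1992) §2.
[cite: FannesNachtergaeleWernerCMP1992] -/
theorem transferOp_posSemidef (A : MPSTensor q D) {X : Matrix (Fin D) (Fin D) ℂ}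
    (hX : X.PosSemidef) : (transferOp A X).PosSemidef := by
  rw [transferOp_apply]
  exact posSemidef_sum _ fun i _ => hX.mul_mul_conjTranspose_same (A i)

/-- **Injectivity** with block length `ℓ`: the word products `A^{w₀} ⋯ A^{w_{ℓ-1}}`,
`w : Fin ℓ → Fin q`, span all of `M_D(ℂ)`; equivalently the map `B ↦ ψ_B` on `ℓ` sites is
injective. Degenerate values: for `ℓ = 0` the only word is empty with product `1`, so
`IsInjectiveMPS A 0 ↔ D ≤ 1`; for `D = 0` it holds for every `ℓ` (`M₀(ℂ) = 0`).
Perez-Garcia–Verstraete–Wolf–Cirac (2007) §3.2, Def. 4 ff.; Fannes–Nachtergaele–Werner (1992)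
§6. [cite: PerezGarciaVerstraeteWolfCiracQIC2007] -/
def IsInjectiveMPS (A : MPSTensor q D) (ℓ : ℕ) : Prop :=
  Submodule.span ℂ (Set.range (wordProduct (ℓ := ℓ) A)) = ⊤

/-- **Normality**: the tensor is injective for some *positive* block length `ℓ` (then for all
larger ones, `IsInjectiveMPS.mono`, so equivalently for all sufficiently large `ℓ`);
equivalently (for a suitably normalised tensor) the transfer operator `𝔼` is primitive, i.e. has
a nondegenerate largest eigenvalue with positive definite eigenvector ("pure finitely correlated
state"). The condition `0 < ℓ` excludes the vacuous witness `ℓ = 0` (see `IsInjectiveMPS`).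
Caveat: for bond dimension `D = 0` every tensor is (vacuously) normal, so statements consuming
`IsNormalMPS` should assume `0 < D`. Perez-Garcia–Verstraete–Wolf–Cirac (2007) §3.2, Lemma 4
and Thm. 5; Fannes–Nachtergaele–Werner (1992) §6. [cite: PerezGarciaVerstraeteWolfCiracQIC2007] -/
def IsNormalMPS (A : MPSTensor q D) : Prop :=
  ∃ ℓ : ℕ, 0 < ℓ ∧ IsInjectiveMPS A ℓ

/-- Injectivity with a *positive* block length `ℓ` propagates to all larger block lengths: if the
words of length `ℓ ≥ 1` span `M_D(ℂ)` then in particular `Σ_i A^i M_D(ℂ) = M_D(ℂ)`, whence the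
words of length `ℓ + 1` span as well. (False for `ℓ = 0`: take `D = 1`, `A = 0`.)
Perez-Garcia–Verstraete–Wolf–Cirac (2007) §3.2, Lemma 4.
[cite: PerezGarciaVerstraeteWolfCiracQIC2007] -/
def IsInjectiveMPS.mono : Prop :=
  ∀ {A : MPSTensor q D} {ℓ ℓ' : ℕ} (h : IsInjectiveMPS A ℓ) (hℓ₀ : 0 < ℓ) (hℓ : ℓ ≤ ℓ'),
    IsInjectiveMPS A ℓ'

/-- A normal tensor is injective for all sufficiently large block lengths. [folklore] -/
def IsNormalMPS.eventually_isInjectiveMPS : Prop :=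
  ∀ {A : MPSTensor q D} (h : IsNormalMPS A),
    ∀ᶠ ℓ in Filter.atTop, IsInjectiveMPS A ℓ

/- interim proof relied on results that are now named facts (D-0014); demoted to a fact by the M5 import, proof preserved:
:= by
  obtain ⟨ℓ, hℓ₀, hℓ⟩ := h
  exact Filter.eventually_atTop.2 ⟨ℓ, fun ℓ' h' => hℓ.mono hℓ₀ h'⟩
-/

/-! ### Parent Hamiltonian -/

/-- The space `𝒢_ℓ = {ψ_B : B ∈ M_D(ℂ)} ≤ ℓ²(Fin ℓ → Fin q)` of MPS on `ℓ` sites with arbitrary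
boundary matrix; for `ℓ` beyond the injectivity length it has dimension `D²` and is the local
ground space of the parent Hamiltonian. Fannes–Nachtergaele–Werner (1992) §5;
Perez-Garcia–Verstraete–Wolf–Cirac (2007) §4. [cite: FannesNachtergaeleWernerCMP1992] -/
def mpsRange (ℓ : ℕ) (A : MPSTensor q D) : Submodule ℂ (SpinSpace (Fin ℓ) q) :=
  Submodule.span ℂ (Set.range fun B : Matrix (Fin D) (Fin D) ℂ =>
    WithLp.toLp 2 (mpsWithBoundary ℓ A B))

/-- The local term `h = 1 - P_{𝒢_ℓ}` of the parent Hamiltonian: the orthogonal projection (as a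
matrix, `projMatrix`) onto the orthogonal complement of the MPS space `𝒢_ℓ` on `ℓ` sites.
Degenerate values: for `ℓ = 0` and `1 ≤ D`, `𝒢₀ = ⊤` (the constants) and the term is `0`; for
`D = 0` (any `ℓ`), `𝒢_ℓ = ⊥` and the term is the identity `1`.
Fannes–Nachtergaele–Werner (1992) §5; Perez-Garcia–Verstraete–Wolf–Cirac (2007) §4, before
Thm. 10. [cite: FannesNachtergaeleWernerCMP1992] -/
def parentLocalTerm (ℓ : ℕ) (A : MPSTensor q D) : Op (Fin ℓ) q :=
  projMatrix (mpsRange ℓ A)ᗮ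

/-- The block `{x, x+1, …, x+ℓ-1} ⊆ ℤ/L` of `ℓ` consecutive sites starting at `x`. [folklore] -/
def ringBlock (L ℓ : ℕ) (x : ZMod L) : Finset (ZMod L) :=
  Finset.univ.image fun i : Fin ℓ => x + (i : ℕ)

/-- The `i`-th site `x + i` of the block `ringBlock L ℓ x`, as an element of the block. For
`ℓ ≤ L` this is a bijection `Fin ℓ ≃ ringBlock L ℓ x`. [folklore] -/
def ringBlockSite (L ℓ : ℕ) (x : ZMod L) (i : Fin ℓ) : ringBlock L ℓ x :=
  ⟨x + (i : ℕ), Finset.mem_image_of_mem _ (Finset.mem_univ i)⟩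

/-- An `ℓ`-site operator `P : Op (Fin ℓ) q` transported to the block `ringBlock L ℓ x` of the ring
`ℤ/L` (pull-back of configurations along `i ↦ x + i`, via `Matrix.submatrix`); an honest
relabelling when `ℓ ≤ L`, a junk value otherwise. [folklore] -/
def onRingBlock (L ℓ : ℕ) (x : ZMod L) (P : Op (Fin ℓ) q) :
    Matrix (ringBlock L ℓ x → Fin q) (ringBlock L ℓ x → Fin q) ℂ :=
  P.submatrix (fun σ i => σ (ringBlockSite L ℓ x i)) (fun σ i => σ (ringBlockSite L ℓ x i))

/-- The translation-invariant **parent Hamiltonian** `H = Σ_{x ∈ ℤ/L} h_{x,…,x+ℓ-1}` of the MPS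
tensor `A` on the ring of `L` sites, with `ℓ`-site local term `h = 1 - P_{𝒢_ℓ}` placed on every
block of `ℓ` consecutive sites via `localOp`. Meaningful for `ℓ ≤ L` (see `onRingBlock`).
Fannes–Nachtergaele–Werner (1992) §5; Perez-Garcia–Verstraete–Wolf–Cirac (2007) §4, Thm. 10.
[cite: FannesNachtergaeleWernerCMP1992] -/
def parentHamiltonian (L : ℕ) [NeZero L] (ℓ : ℕ) (A : MPSTensor q D) : Op (ZMod L) q :=
  ∑ x : ZMod L, localOp (ringBlock L ℓ x) (onRingBlock L ℓ x (parentLocalTerm ℓ A))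

/-- The block `{x, …, x+ℓ-1} ⊆ Fin L` of the open chain, given `x + ℓ ≤ L`. [folklore] -/
def chainBlock (L ℓ : ℕ) (x : Fin L) (h : (x : ℕ) + ℓ ≤ L) : Finset (Fin L) :=
  Finset.univ.image fun i : Fin ℓ => (⟨x + i, by omega⟩ : Fin L)

/-- The `i`-th site of `chainBlock L ℓ x h`, as an element of the block. [folklore] -/
def chainBlockSite (L ℓ : ℕ) (x : Fin L) (h : (x : ℕ) + ℓ ≤ L) (i : Fin ℓ) : chainBlock L ℓ x h :=
  ⟨⟨x + i, by omega⟩, Finset.mem_image_of_mem _ (Finset.mem_univ i)⟩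

/-- The **parent Hamiltonian with open boundary conditions** `H = Σ_{x : x+ℓ ≤ L} h_{x,…,x+ℓ-1}` on
the chain `Fin L`. Fannes–Nachtergaele–Werner (1992) §5; Perez-Garcia–Verstraete–Wolf–Cirac
(2007) §4.2. [cite: FannesNachtergaeleWernerCMP1992] -/
def parentHamiltonianOpen (L ℓ : ℕ) (A : MPSTensor q D) : Op (Fin L) q :=
  ∑ x : Fin L, if h : (x : ℕ) + ℓ ≤ L then
    localOp (chainBlock L ℓ x h) ((parentLocalTerm ℓ A).submatrix
      (fun σ i => σ (chainBlockSite L ℓ x h i)) (fun σ i => σ (chainBlockSite L ℓ x h i)))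
    else 0

/-- The parent Hamiltonian is Hermitian (a sum of local projections; elementary, recorded as a
named fact). Fannes–Nachtergaele–Werner (1992) §5. [cite: FannesNachtergaeleWernerCMP1992, §5] -/
def parentHamiltonian_isHermitian : Prop :=
  ∀ (L : ℕ) [NeZero L] (ℓ : ℕ) (A : MPSTensor q D),
    (parentHamiltonian L ℓ A).IsHermitian

/-- The parent Hamiltonian is positive semidefinite (a sum of local projections; elementary,
recorded as a named fact). Fannes–Nachtergaele–Werner (1992) §5.
[cite: FannesNachtergaeleWernerCMP1992, §5] -/
def parentHamiltonian_posSemidef : Prop :=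
  ∀ (L : ℕ) [NeZero L] (ℓ : ℕ) (A : MPSTensor q D),
    (parentHamiltonian L ℓ A).PosSemidef

/-- **Ground-state property.** The periodic MPS is annihilated by its parent Hamiltonian
(`ℓ ≤ L`): every local term `h_{x,…,x+ℓ-1} = 1 - P_{𝒢_ℓ}` kills `ψ`, whose restriction to any
block lies in `𝒢_ℓ`. Fannes–Nachtergaele–Werner (1992) §5, Prop. 5.1;
Perez-Garcia–Verstraete–Wolf–Cirac (2007) §4, Thm. 10. [cite: FannesNachtergaeleWernerCMP1992] -/
def parentHamiltonian_mulVec_mps_eq_zero : Prop :=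
  ∀ (L : ℕ) [NeZero L] (ℓ : ℕ) (hℓ : ℓ ≤ L) (A : MPSTensor q D),
    parentHamiltonian L ℓ A *ᵥ (fun σ : TensorIndex (ZMod L) q =>
      mpsPeriodic L A (σ ∘ ZMod.finEquiv L)) = 0

/-- The MPS with any boundary matrix, restricted to the open chain, is annihilated by the open
parent Hamiltonian (no hypothesis `ℓ ≤ L` is needed: for `ℓ > L` the open Hamiltonian is `0`).
Fannes–Nachtergaele–Werner (1992) §5; Perez-Garcia–Verstraete–Wolf–Cirac (2007) §4.2.
[cite: FannesNachtergaeleWernerCMP1992] -/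
def parentHamiltonianOpen_mulVec_mpsWithBoundary_eq_zero : Prop :=
  ∀ (L ℓ : ℕ) (A : MPSTensor q D) (B : Matrix (Fin D) (Fin D) ℂ),
    parentHamiltonianOpen L ℓ A *ᵥ mpsWithBoundary L A B = 0

/-! ### The AKLT tensor -/

/-- The **AKLT tensor** (spin `1`, bond dimension `2`): with the physical index convention
`k : Fin 3 ↦ m = 1 - k` of `spinZ 2`,
`A^{+1} = √(2/3) σ⁺ = √(2/3) [[0,1],[0,0]]`, `A^{0} = -√(1/3) σᶻ = -√(1/3) [[1,0],[0,-1]]`,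
`A^{-1} = -√(2/3) σ⁻ = -√(2/3) [[0,0],[1,0]]`. It satisfies `Σ_i A^i (A^i)† = 1`.
AKLT, CMP 115 (1988) §2; Fannes–Nachtergaele–Werner (1992) §7; Schollwöck (2011) §4.1.5,
eq. (79). [cite: FannesNachtergaeleWernerCMP1992] -/
def akltTensor : MPSTensor 3 2 :=
  ![((Real.sqrt (2 / 3) : ℝ) : ℂ) • !![0, 1; 0, 0],
    (-(Real.sqrt (1 / 3) : ℝ) : ℂ) • !![1, 0; 0, -1],
    (-(Real.sqrt (2 / 3) : ℝ) : ℂ) • !![0, 0; 1, 0]]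

/-- The AKLT tensor is normalised: `𝔼(1) = Σ_i A^i (A^i)† = 1`. Schollwöck (2011) §4.1.5.
[cite: Schollwock2011] -/
def transferOp_akltTensor_one : Prop :=
  transferOp akltTensor 1 = 1

/-- The AKLT tensor is normal; indeed it is injective with block length `2` (the four products
`A^i A^j` span `M₂(ℂ)`). Fannes–Nachtergaele–Werner (1992) §7;
Perez-Garcia–Verstraete–Wolf–Cirac (2007) §3.2. [cite: FannesNachtergaeleWernerCMP1992] -/
def isNormalMPS_akltTensor : Prop :=
  IsNormalMPS akltTensor

/-- **The AKLT Hamiltonian is the parent Hamiltonian of the AKLT tensor.** With block length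
`ℓ = 2` the MPS space `𝒢₂` is the bond-spin `0 ⊕ 1` sector, so the local term is the projection
`P₂ = ⅙ (𝐒_x · 𝐒_y)² + ½ 𝐒_x · 𝐒_y + ⅓` onto bond spin `2`, and on the ring `ℤ/L` (`2 ≤ L`)
`H_parent = Σ_i P₂(i, i+1) = ½ H_AKLT + L/3` where `H_AKLT = Σ_i (𝐒_i · 𝐒_{i+1} + ⅓ (𝐒_i · 𝐒_{i+1})²)`
(`akltHamiltonian` of `Literature.Prelude.QLatticeAQFT.HeisenbergModel` on the cycle).
AKLT, CMP 115 (1988), eq. (1.2) and §2; Fannes–Nachtergaele–Werner (1992) §7;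
Tasaki (2020) §7.1. [cite: FannesNachtergaeleWernerCMP1992] -/
def parentHamiltonian_akltTensor_eq : Prop :=
  ∀ (L : ℕ) [NeZero L] (hL : 2 ≤ L),
    parentHamiltonian L 2 akltTensor =
      ∑ i : ZMod L, ((1 / 6 : ℂ) • (spinDot 2 i (i + 1) * spinDot 2 i (i + 1)) +
        (1 / 2 : ℂ) • spinDot 2 i (i + 1) + (1 / 3 : ℂ) • (1 : Op (ZMod L) 3))

end QLattice

end Literature.MathematicalPhysics.QuantumLattice
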